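import Mathlib
import HarnessLib

/-!
# LINE (A) `product_plus_one` (crux `MatrixDescartes`, stmt-ValiantsHypothesis-18050, V1) — W-CB, brick E2a of the ORDER-6 ADDITIVE CERTIFICATE:
# the abstract θ-SHELL OF ORDER SIX («seven zeros of `S` in a window ⇒ a zero of `∏ᵢ(θ² − (kᵢ+1)²) S`»)

Abstract Rolle bookkeeping in the θ-calculus of ✓ `…ProductPlusOneThetaShell` (val-lit-p5 g16: `no_three_zeros_of_theta_sq_law`, ONE factor
`θ² − (n+1)²`).  Data: a window `(u, v)` with `0 ≤ u` and a tower of functions `S₀, S₁, …, S₆ : ℝ → ℝ` with `HasDerivAt Sᵢ (Sᵢ₊₁ x / x) x` on the window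
(`Sᵢ₊₁ = θSᵢ`, `θ = x·d/dx`); three natural rates `k₁+1, k₂+1, k₃+1`.

* `theta_rolle_up` / `theta_rolle_down` — ONE first-order Rolle step in θ-form: two zeros `a < b` of `R` give a zero of `(k+1)·R + θR` (via `t^{k+1}·R`)
  resp. of `θR − (k+1)·R` (via `R / t^{k+1}`) strictly between;
* `theta_rolle_up_chain` / `theta_rolle_down_chain` — the same along a strictly increasing chain of `m + 2` zeros: a strictly increasing chain of `m + 1` zeros
  of the image, nested inside;
* `theta_sq_chain` — one factor `θ² − (k+1)²`: `m + 3` zeros of `R` ⇒ `m + 1` zeros of `θ²R − (k+1)²R` (both Rolle steps);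
* ★ `no_seven_zeros_of_sixth_order_law` — if `L₃S := S₆ − e₁S₄ + e₂S₂ − e₃S₀` (`e₁ = Σλᵢ²`, `e₂ = Σλᵢ²λⱼ²`, `e₃ = λ₁²λ₂²λ₃²`, `λᵢ = kᵢ+1`) is NOWHERE ZERO on the
  window, `S₀` has no strictly increasing chain of SEVEN zeros there (`x : Fin 7 → ℝ`, `StrictMono x`).

USE (E2b/E3, next files): for a BINOMIAL company `S₀ = Σ_rows ψ₁` and the binomial tower closure (✓/⧗ `…SixthOrderRowLaws`: `ψ₂² = r²ψ₁² + 4ψ₁³`,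
`ψ₃ = r²ψ₁ + 6ψ₁²`) makes every `Sᵢ` an explicit polynomial in the rows' `ψ₁, ψ₂`, and `L₃S = Σ_rows Q_{r_j}(ψ₁)` with the one-signed `Q`'s of E1 —
so a window missed by every fast ring has at most six roots of `W(∏ f)` (memo `NOTE-p7g18-18050-LINEA-sixth-order-certificate.md` §3).

HONEST FRAMING: abstract calculus (Rolle ×6); proves nothing about `WronskianBudgetK3` / `OneChangeFloorK3` / the stubs / 18050 / `MatrixDescartes` / B by itself;
`VP ≠ VNP` is NOT proved.  No definitions, no named facts, no sorry; Mathlib + HarnessLib only.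
-/

set_option linter.dupNamespace false

namespace Summit.ValiantsHypothesis.ValiantsHypothesis.Theorems.LacunarySymmetroidMatrixDescartes

namespace ProductPlusOne

open Set

/-! ### §1 One first-order Rolle step in θ-form -/

/-- **Up-step**: `R(a) = R(b) = 0`, `a < b` inside `(u,v)` (`0 ≤ u`), `θR = R₁` ⇒ some `c ∈ (a,b)` has `(k+1)·R(c) + R₁(c) = 0`
(Rolle for `t^{k+1}·R`). [this file's lemma] -/
theorem theta_rolle_up (k : ℕ) {R R₁ : ℝ → ℝ} {u v : ℝ} (hu : 0 ≤ u)
    (hR : ∀ x ∈ Ioo u v, HasDerivAt R (R₁ x / x) x) {a b : ℝ} (ha : a ∈ Ioo u v) (hb : b ∈ Ioo u v) (hab : a < b)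
    (hza : R a = 0) (hzb : R b = 0) : ∃ c ∈ Ioo a b, ((k : ℝ) + 1) * R c + R₁ c = 0 := by
  have hpos : ∀ x ∈ Ioo u v, 0 < x := fun x hx => hu.trans_lt hx.1
  have hF : ∀ x ∈ Ioo u v, HasDerivAt (fun t : ℝ => t ^ (k + 1) * R t) (x ^ k * (((k : ℝ) + 1) * R x + R₁ x)) x := by
    intro x hx
    have hx0 : x ≠ 0 := (hpos x hx).ne'
    have hp : HasDerivAt (fun t : ℝ => t ^ (k + 1)) (((k + 1 : ℕ) : ℝ) * x ^ k) x := by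
      simpa using hasDerivAt_pow (k + 1) x
    refine (hp.mul (hR x hx)).congr_deriv ?_
    push_cast
    rw [pow_succ]
    field_simp
  have hsub : Icc a b ⊆ Ioo u v := fun t ht => ⟨ha.1.trans_le ht.1, ht.2.trans_lt hb.2⟩
  have hcont : ContinuousOn (fun t : ℝ => t ^ (k + 1) * R t) (Icc a b) :=
    fun x hx => (hF x (hsub hx)).continuousAt.continuousWithinAt
  obtain ⟨c, hc, hc'⟩ := exists_hasDerivAt_eq_zero hab hcont (by simp [hza, hzb])
    (fun t ht => hF t (hsub (Ioo_subset_Icc_self ht)))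
  refine ⟨c, hc, ?_⟩
  have hcI : c ∈ Ioo u v := hsub (Ioo_subset_Icc_self hc)
  exact (mul_eq_zero.1 hc').resolve_left (pow_ne_zero _ (hpos c hcI).ne')

/-- **Down-step**: `N(a) = N(b) = 0`, `a < b` inside `(u,v)` (`0 ≤ u`), `θN = N₁` ⇒ some `c ∈ (a,b)` has `N₁(c) − (k+1)·N(c) = 0`
(Rolle for `N / t^{k+1}`). [this file's lemma] -/
theorem theta_rolle_down (k : ℕ) {N N₁ : ℝ → ℝ} {u v : ℝ} (hu : 0 ≤ u)
    (hN : ∀ x ∈ Ioo u v, HasDerivAt N (N₁ x / x) x) {a b : ℝ} (ha : a ∈ Ioo u v) (hb : b ∈ Ioo u v) (hab : a < b)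
    (hza : N a = 0) (hzb : N b = 0) : ∃ c ∈ Ioo a b, N₁ c - ((k : ℝ) + 1) * N c = 0 := by
  have hpos : ∀ x ∈ Ioo u v, 0 < x := fun x hx => hu.trans_lt hx.1
  have hF : ∀ x ∈ Ioo u v, HasDerivAt (fun t : ℝ => N t / t ^ (k + 1)) ((N₁ x - ((k : ℝ) + 1) * N x) / x ^ (k + 2)) x := by
    intro x hx
    have hx0 : x ≠ 0 := (hpos x hx).ne'
    have hp : HasDerivAt (fun t : ℝ => t ^ (k + 1)) (((k + 1 : ℕ) : ℝ) * x ^ k) x := by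
      simpa using hasDerivAt_pow (k + 1) x
    refine ((hN x hx).div hp (pow_ne_zero _ hx0)).congr_deriv ?_
    push_cast
    rw [pow_succ, pow_succ, pow_succ]
    field_simp
    ring
  have hsub : Icc a b ⊆ Ioo u v := fun t ht => ⟨ha.1.trans_le ht.1, ht.2.trans_lt hb.2⟩
  have hcont : ContinuousOn (fun t : ℝ => N t / t ^ (k + 1)) (Icc a b) :=
    fun x hx => (hF x (hsub hx)).continuousAt.continuousWithinAt
  obtain ⟨c, hc, hc'⟩ := exists_hasDerivAt_eq_zero hab hcont (by simp [hza, hzb])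
    (fun t ht => hF t (hsub (Ioo_subset_Icc_self ht)))
  refine ⟨c, hc, ?_⟩
  have hcI : c ∈ Ioo u v := hsub (Ioo_subset_Icc_self hc)
  exact (div_eq_zero_iff.1 hc').resolve_right (pow_ne_zero _ (hpos c hcI).ne')

/-! ### §2 Chains of zeros -/

/-- **Generic chain step**: if between any two zeros `a < b` of `R` in the window there is a zero of `T`, then a strictly increasing chain of `m + 2`
zeros of `R` yields a strictly increasing chain of `m + 1` zeros of `T`, nested strictly inside. [this file's lemma] -/
theorem chain_step {R T : ℝ → ℝ} {u v : ℝ}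
    (hstep : ∀ a b, a ∈ Ioo u v → b ∈ Ioo u v → a < b → R a = 0 → R b = 0 → ∃ c ∈ Ioo a b, T c = 0)
    {m : ℕ} (x : Fin (m + 2) → ℝ) (hx : StrictMono x) (hxI : ∀ i, x i ∈ Ioo u v) (hz : ∀ i, R (x i) = 0) :
    ∃ y : Fin (m + 1) → ℝ, StrictMono y ∧ (∀ i, y i ∈ Ioo u v) ∧ (∀ i, T (y i) = 0) ∧
      x 0 < y 0 ∧ y (Fin.last m) < x (Fin.last (m + 1)) := by
  have key : ∀ i : Fin (m + 1), ∃ c ∈ Ioo (x i.castSucc) (x i.succ), T c = 0 := fun i =>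
    have hlt : i.castSucc < i.succ := Fin.castSucc_lt_succ
    hstep _ _ (hxI _) (hxI _) (hx hlt) (hz _) (hz _)
  choose y hy hTy using key
  refine ⟨y, ?_, fun i => ?_, hTy, ?_, ?_⟩
  · intro i j hij
    have h1 : y i < x i.succ := (hy i).2
    have h2 : x j.castSucc < y j := (hy j).1
    have h3 : x i.succ ≤ x j.castSucc := hx.monotone (by
      rw [Fin.le_def, Fin.val_castSucc, Fin.val_succ]; exact Nat.succ_le_of_lt hij)
    exact h1.trans_le (h3.trans h2.le)
  · exact ⟨(hxI _).1.trans (hy i).1, (hy i).2.trans (hxI _).2⟩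
  · exact (hy 0).1
  · have h := (hy (Fin.last m)).2
    have : (Fin.last m).succ = Fin.last (m + 1) := Fin.succ_last m
    rw [this] at h
    exact h

/-- **One factor `θ² − (k+1)²`**: with `θR = R₁`, `θR₁ = R₂` on the window, a strictly increasing chain of `m + 3` zeros of `R` yields a strictly
increasing chain of `m + 1` zeros of `x ↦ R₂ x − (k+1)²·R x`, nested strictly inside. [this file's lemma] -/
theorem theta_sq_chain (k : ℕ) {R R₁ R₂ : ℝ → ℝ} {u v : ℝ} (hu : 0 ≤ u)
    (hR : ∀ x ∈ Ioo u v, HasDerivAt R (R₁ x / x) x) (hR₁ : ∀ x ∈ Ioo u v, HasDerivAt R₁ (R₂ x / x) x)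
    {m : ℕ} (x : Fin (m + 3) → ℝ) (hx : StrictMono x) (hxI : ∀ i, x i ∈ Ioo u v) (hz : ∀ i, R (x i) = 0) :
    ∃ z : Fin (m + 1) → ℝ, StrictMono z ∧ (∀ i, z i ∈ Ioo u v) ∧ (∀ i, R₂ (z i) - ((k : ℝ) + 1) ^ 2 * R (z i) = 0) ∧
      x 0 < z 0 ∧ z (Fin.last m) < x (Fin.last (m + 2)) := by
  -- first step: zeros of N := (k+1)R + R₁
  obtain ⟨y, hy, hyI, hNy, hy0, hyl⟩ := chain_step (R := R) (T := fun t => ((k : ℝ) + 1) * R t + R₁ t)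
    (fun a b ha hb hab hza hzb => theta_rolle_up k hu hR ha hb hab hza hzb) x hx hxI hz
  -- second step: zeros of θN − (k+1)N = R₂ − (k+1)²R
  have hN : ∀ t ∈ Ioo u v, HasDerivAt (fun t => ((k : ℝ) + 1) * R t + R₁ t) ((((k : ℝ) + 1) * R₁ t + R₂ t) / t) t := by
    intro t ht
    have h := ((hR t ht).const_mul ((k : ℝ) + 1)).add (hR₁ t ht)
    refine h.congr_deriv ?_
    have ht0 : t ≠ 0 := (hu.trans_lt ht.1).ne'
    field_simp
  obtain ⟨z, hz', hzI, hTz, hz0, hzl⟩ := chain_step (R := fun t => ((k : ℝ) + 1) * R t + R₁ t)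
    (T := fun t => (((k : ℝ) + 1) * R₁ t + R₂ t) - ((k : ℝ) + 1) * (((k : ℝ) + 1) * R t + R₁ t))
    (fun a b ha hb hab hza hzb => theta_rolle_down k hu hN ha hb hab hza hzb) y hy hyI hNy
  refine ⟨z, hz', hzI, fun i => ?_, hy0.trans hz0, hzl.trans hyl⟩
  have h := hTz i
  linarith

/-! ### §3 The order-6 law -/

/-- ★ **THE θ-SHELL OF ORDER SIX.**  Tower `S₀ … S₆` with `θSᵢ = Sᵢ₊₁` on the window `(u,v)`, `0 ≤ u`; natural rates `kᵢ + 1`; if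
`L₃S := S₆ − e₁·S₄ + e₂·S₂ − e₃·S₀ ≠ 0` on the window (one-signed in the applications) (`e₁ = λ₁²+λ₂²+λ₃²`, `e₂ = λ₁²λ₂² + λ₁²λ₃² + λ₂²λ₃²`, `e₃ = λ₁²λ₂²λ₃²`, `λᵢ = kᵢ + 1` — this is
`(θ² − λ₃²)(θ² − λ₂²)(θ² − λ₁²)S₀`), then `S₀` has NO strictly increasing chain of seven zeros in the window. [this file's theorem] -/
theorem no_seven_zeros_of_sixth_order_law (k₁ k₂ k₃ : ℕ) {S₀ S₁ S₂ S₃ S₄ S₅ S₆ : ℝ → ℝ} {u v : ℝ} (hu : 0 ≤ u)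
    (h0 : ∀ x ∈ Ioo u v, HasDerivAt S₀ (S₁ x / x) x) (h1 : ∀ x ∈ Ioo u v, HasDerivAt S₁ (S₂ x / x) x)
    (h2 : ∀ x ∈ Ioo u v, HasDerivAt S₂ (S₃ x / x) x) (h3 : ∀ x ∈ Ioo u v, HasDerivAt S₃ (S₄ x / x) x)
    (h4 : ∀ x ∈ Ioo u v, HasDerivAt S₄ (S₅ x / x) x) (h5 : ∀ x ∈ Ioo u v, HasDerivAt S₅ (S₆ x / x) x)
    (hlaw : ∀ x ∈ Ioo u v,
      S₆ x - (((k₁ : ℝ) + 1) ^ 2 + ((k₂ : ℝ) + 1) ^ 2 + ((k₃ : ℝ) + 1) ^ 2) * S₄ x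
        + (((k₁ : ℝ) + 1) ^ 2 * ((k₂ : ℝ) + 1) ^ 2 + ((k₁ : ℝ) + 1) ^ 2 * ((k₃ : ℝ) + 1) ^ 2
            + ((k₂ : ℝ) + 1) ^ 2 * ((k₃ : ℝ) + 1) ^ 2) * S₂ x
        - ((k₁ : ℝ) + 1) ^ 2 * ((k₂ : ℝ) + 1) ^ 2 * ((k₃ : ℝ) + 1) ^ 2 * S₀ x ≠ 0)
    (x : Fin 7 → ℝ) (hx : StrictMono x) (hxI : ∀ i, x i ∈ Ioo u v) (hz : ∀ i, S₀ (x i) = 0) : False := by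
  -- level 1: T = S₂ − λ₁²S₀ with tower T, T₁ = S₃ − λ₁²S₁, T₂ = S₄ − λ₁²S₂, …
  set a : ℝ := ((k₁ : ℝ) + 1) ^ 2 with ha
  set b : ℝ := ((k₂ : ℝ) + 1) ^ 2 with hb
  set c : ℝ := ((k₃ : ℝ) + 1) ^ 2 with hc
  have hpos : ∀ x ∈ Ioo u v, (x : ℝ) ≠ 0 := fun x hx => (hu.trans_lt hx.1).ne'
  -- generic linear-combination derivative helper
  have lin : ∀ {F F₁ G G₁ : ℝ → ℝ} (μ : ℝ), (∀ x ∈ Ioo u v, HasDerivAt F (F₁ x / x) x) → (∀ x ∈ Ioo u v, HasDerivAt G (G₁ x / x) x) →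
      ∀ x ∈ Ioo u v, HasDerivAt (fun t => F t - μ * G t) ((F₁ x - μ * G₁ x) / x) x := by
    intro F F₁ G G₁ μ hF hG x hx
    have h := (hF x hx).sub ((hG x hx).const_mul μ)
    refine h.congr_deriv ?_
    field_simp
  obtain ⟨y, hy, hyI, hTy, -, -⟩ := theta_sq_chain k₁ hu h0 h1 (m := 4) x hx hxI hz
  -- y : Fin 5 → ℝ zeros of T := S₂ − a S₀
  have hT0 : ∀ x ∈ Ioo u v, HasDerivAt (fun t => S₂ t - a * S₀ t) ((S₃ x - a * S₁ x) / x) x := lin a h2 h0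
  have hT1 : ∀ x ∈ Ioo u v, HasDerivAt (fun t => S₃ t - a * S₁ t) ((S₄ x - a * S₂ x) / x) x := lin a h3 h1
  obtain ⟨z, hz', hzI, hUz, -, -⟩ := theta_sq_chain k₂ hu hT0 hT1 (m := 2) y hy hyI (fun i => by simpa [ha] using hTy i)
  -- z : Fin 3 → ℝ zeros of U := (S₄ − aS₂) − b(S₂ − aS₀)
  have hU0 : ∀ x ∈ Ioo u v, HasDerivAt (fun t => (S₄ t - a * S₂ t) - b * (S₂ t - a * S₀ t))
      (((S₅ x - a * S₃ x) - b * (S₃ x - a * S₁ x)) / x) x := lin b (lin a h4 h2) (lin a h2 h0)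
  have hU1 : ∀ x ∈ Ioo u v, HasDerivAt (fun t => (S₅ t - a * S₃ t) - b * (S₃ t - a * S₁ t))
      (((S₆ x - a * S₄ x) - b * (S₄ x - a * S₂ x)) / x) x := lin b (lin a h5 h3) (lin a h3 h1)
  obtain ⟨w, -, hwI, hVw, -, -⟩ := theta_sq_chain k₃ hu hU0 hU1 (m := 0) z hz' hzI (fun i => by simpa [hb] using hUz i)
  have hw := hVw 0
  have hl := hlaw (w 0) (hwI 0)
  -- the level-3 value is exactly L₃S
  have : ((S₆ (w 0) - a * S₄ (w 0)) - b * (S₄ (w 0) - a * S₂ (w 0))) - c * ((S₄ (w 0) - a * S₂ (w 0)) - b * (S₂ (w 0) - a * S₀ (w 0)))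
      = S₆ (w 0) - (a + b + c) * S₄ (w 0) + (a * b + a * c + b * c) * S₂ (w 0) - a * b * c * S₀ (w 0) := by ring
  rw [← hc] at hw
  exact hl (by linarith [hw, this])

end ProductPlusOne

end Summit.ValiantsHypothesis.ValiantsHypothesis.Theorems.LacunarySymmetroidMatrixDescartes
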